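import Literature.Topology.FourManifolds.NeckCapTransport
import Literature.Topology.FourManifolds.HeegaardSplittingRealizationProofs
import Literature.Topology.FourManifolds.KneserMilnorRetractViaRank
import HarnessLib

/-!
# Surgery along a separating sphere with a product neighbourhood

Topic `Literature/Topology/FourManifolds`; infrastructure for the fact seat
`provefact-Literature.Topology.FourManifolds.kneserMilnor_retract_alternative` (J. Hempel,
*3-Manifolds* (1976), Ch. 3: the cut-and-paste step "cut `M` along a 2-sphere `S` and cap off the
two boundary spheres with 3-cells", Lemma 3.8 and p. 21, in the smooth category).

A *neck* of a manifold `P` modelled on the inner product space `E ⊇ Sⁿ` (`dim E = n + 1`) is a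
smooth embedding `ψ : Sⁿ × ℝ → P` with open range — a two-sided, bicollared embedded `n`-sphere
`ψ (Sⁿ × {0})` together with a product neighbourhood.  The tree's `NeckCapping.lean` caps a
*side* `D : NeckCapData n ψ` of a neck by a disc (`D.Capped`), and `NeckCapData.isConnectedSum_capped`
presents `P` as the connected sum of the two capped sides when the middle sphere separates.  This
file adds what the Kneser–Milnor argument needs on top of that:

* `NeckCapData.isOrientable_capped` — **the capped side of an orientable manifold is orientable**
  (the side is an open submanifold, the disc is orientable, and they are glued along the connected
  upper half-neck `ψ (Sⁿ × (0, ∞))`; Hirsch, *Differential Topology*, §4.4, Kosinski VI (1.1), via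
  the tree's `SmoothGlueData.isOrientable_glued`);
* `homotopic_neckLevel` — the level spheres `θ ↦ ψ (θ, a)` and `θ ↦ ψ (θ, b)` of a neck are
  homotopic in `P`;
* `NeckCapData.exists_homotopic_const_middleSphere` (dimension `3`) — **if the capped side of a
  neck in a closed `3`-manifold is simply connected, the middle sphere `θ ↦ ψ (θ, 0)` is
  null-homotopic**: it is homotopic to the level-`1` sphere, which lies in the side
  `A ≅ D.Capped ∖ {centre}`, and a `2`-sphere in a once-punctured simply connected closed
  `3`-manifold is null-homotopic (`homotopic_const_of_simplyConnected_compl_singleton`,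
  `KneserMilnorRetractViaRank.lean`: Poincaré duality and Hurewicz; Hempel, proof of Thm. 3.6 /
  Lemma 3.13: a sphere bounding a (homotopy) ball is inessential);
* `exists_neckCapData_of_separating_three` — **surgery along a separating neck of a closed,
  connected, orientable `3`-manifold `Y`**: the two sides `D₁`, `D₂` exist
  (`exists_neckCapData_of_not_isPreconnected`), `Y ≅ D₁.Capped # D₂.Capped` (`IsConnectedSum`),
  and both capped sides are closed, connected, orientable `3`-manifolds (Hempel 1976, Ch. 3 p. 21
  and Lemma 3.8, separating case).

Everything here is proved; no definitions, no named facts.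

## References

* J. Hempel, *3-Manifolds*, Ann. of Math. Studies 86, Princeton Univ. Press (1976), Ch. 3,
  p. 21 (connected sum by cutting along a separating sphere and capping), Lemma 3.8, proof of
  Lemma 3.13. [Hempel1976]
* M. W. Hirsch, *Differential Topology*, GTM 33 (1976), Ch. 4 §4 (orientations), Lemma 4.4.
  [Hirsch1976]
* A. Kosinski, *Differential Manifolds* (1993), Ch. VI §1 (1.1), §2. [Kosinski1993]
-/

open scoped Manifold ContDiff Topology
open Set Function Metric Module

noncomputable section

namespace Literature.Topology.FourManifolds

/-! ### Orientability of the capped side -/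

section General

universe u

variable {E : Type u} [NormedAddCommGroup E] [InnerProductSpace ℝ E] {n : ℕ}
  [Fact (finrank ℝ E = n + 1)] {P : Type u} [TopologicalSpace P] [ChartedSpace E P]
  {ψ : sphere (0 : E) 1 × ℝ → P}

namespace NeckCapData

/-- The gluing region of the cap, seen in `P`, is the upper half-neck `ψ (Sⁿ × (0, ∞))`.
[folklore] -/
theorem image_coe_glue_source (D : NeckCapData n ψ) :
    Subtype.val '' D.glueData.glue.source = ψ '' (univ ×ˢ Ioi (0 : ℝ)) := by
  ext p
  constructor
  · rintro ⟨a, ha, rfl⟩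
    obtain ⟨θ, t, ht, hθ⟩ := D.mem_glueP_source.1 (D.mem_glue_source.1 ha)
    exact ⟨(θ, t), ⟨mem_univ _, ht⟩, hθ⟩
  · rintro ⟨⟨θ, t⟩, ⟨-, ht⟩, rfl⟩
    refine ⟨⟨ψ (θ, t), D.mem_side θ ht⟩, ?_, rfl⟩
    exact D.mem_glue_source.2 (D.mem_glueP_source.2 ⟨θ, t, ht, rfl⟩)

/-- The gluing region of the cap is preconnected when `n ≠ 0` (it is homeomorphic to the upper
half-neck `Sⁿ × (0, ∞)`, and `Sⁿ` is connected). [folklore] -/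
theorem isPreconnected_glue_source (D : NeckCapData n ψ) (hn : n ≠ 0) :
    IsPreconnected D.glueData.glue.source := by
  haveI : FiniteDimensional ℝ E := .of_fact_finrank_eq_succ (K := ℝ) (V := E) n
  haveI : ConnectedSpace (sphere (0 : E) 1) := by
    have h1 : 1 < Module.rank ℝ E := by
      rw [← Module.finrank_eq_rank, (Fact.out : finrank ℝ E = n + 1)]
      exact_mod_cast (by omega : 1 < n + 1)
    exact isConnected_iff_connectedSpace.1 (isConnected_sphere h1 (0 : E) zero_le_one)
  have hs : IsPreconnected (ψ '' (univ ×ˢ Ioi (0 : ℝ))) :=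
    (isPreconnected_univ.prod isPreconnected_Ioi).image _ D.isOpenEmbedding.continuous.continuousOn
  have heq : D.glueData.glue.source = (Subtype.val : D.side → P) ⁻¹' (ψ '' (univ ×ˢ Ioi (0 : ℝ))) := by
    ext a
    rw [mem_preimage]
    constructor
    · intro ha
      obtain ⟨θ, t, ht, hθ⟩ := D.mem_glueP_source.1 (D.mem_glue_source.1 ha)
      exact ⟨(θ, t), ⟨mem_univ _, ht⟩, hθ⟩
    · rintro ⟨⟨θ, t⟩, ⟨-, ht⟩, hθ⟩
      exact D.mem_glue_source.2 (D.mem_glueP_source.2 ⟨θ, t, ht, hθ⟩)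
  rw [heq]
  refine hs.preimage_of_isOpenMap Subtype.val_injective D.side.2.isOpenMap_subtype_val ?_
  rw [Subtype.range_coe]
  exact D.image_Ioi_subset

/-- **The capped side of an orientable manifold is orientable** (`n ≠ 0`): the side `A ⊆ P` is an
orientable open submanifold, the disc `E` is orientable (simply connected), and the two are glued
along the connected region `ψ (Sⁿ × (0, ∞))`, so the orientations can be matched and glued
(Hirsch, *Differential Topology*, §4.4; Kosinski VI (1.1); the tree's
`SmoothGlueData.isOrientable_glued`). [cite: Hirsch1976, Ch. 4 §4] -/
theorem isOrientable_capped (D : NeckCapData n ψ) [IsManifold 𝓘(ℝ, E) ∞ P]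
    (hP : IsOrientable 𝓘(ℝ, E) P) (hn : n ≠ 0) : IsOrientable 𝓘(ℝ, E) D.Capped := by
  have hA : IsOrientable 𝓘(ℝ, E) D.side := hP.opens D.side
  have hB : IsOrientable 𝓘(ℝ, E) E := isOrientable_of_simplyConnectedSpace_holds
  exact D.glueData.isOrientable_glued hA hB (D.isPreconnected_glue_source hn)

end NeckCapData

end General

/-! ### Level slices of a neck are homotopic -/

section Level

variable {S P : Type*} [TopologicalSpace S] [TopologicalSpace P]

/-- **Two level slices `θ ↦ ψ (θ, a)`, `θ ↦ ψ (θ, b)` of a (continuous) neck `ψ : S × ℝ → P` are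
homotopic** in `P`, by sliding the level: `(s, θ) ↦ ψ (θ, (1 - s) a + s b)`. [folklore] -/
theorem homotopic_neckLevel {ψ : S × ℝ → P} (hψ : Continuous ψ) (a b : ℝ) :
    (⟨fun θ => ψ (θ, a), hψ.comp (Continuous.prodMk_left a)⟩ : C(S, P)).Homotopic
      ⟨fun θ => ψ (θ, b), hψ.comp (Continuous.prodMk_left b)⟩ := by
  refine ⟨{ toFun := fun q => ψ (q.2, (1 - (q.1 : ℝ)) * a + (q.1 : ℝ) * b)
            continuous_toFun := ?_
            map_zero_left := fun θ => ?_
            map_one_left := fun θ => ?_ }⟩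
  · refine hψ.comp (continuous_snd.prodMk ?_)
    have h1 : Continuous fun q : unitInterval × S => (q.1 : ℝ) :=
      continuous_subtype_val.comp continuous_fst
    exact ((continuous_const.sub h1).mul continuous_const).add (h1.mul continuous_const)
  · simp
  · simp

end Level

/-! ### The two sides of a separating neck -/

section Sides

universe u v

variable {E : Type v} [NormedAddCommGroup E] [InnerProductSpace ℝ E] {n : ℕ}
  [Fact (finrank ℝ E = n + 1)] {P : Type u} [TopologicalSpace P] [ChartedSpace E P]

/-- **A separating neck has two sides.** If `P` is Hausdorff and connected, `n ≠ 0` (so that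
`Sⁿ` is connected), `ψ : Sⁿ × ℝ → P` is a neck and the complement of its middle sphere
`ψ (Sⁿ × {0})` is not (pre)connected, then the two halves of `P ∖ ψ (Sⁿ × {0})`
(`Literature.Topology.FourManifolds.exists_two_sides_of_neck_of_not_isPreconnected`; Hirsch, *Differential Topology*, Ch. 4,
Lemma 4.4) are sides of `ψ` and of the flipped neck, disjoint and covering `P` off the middle
sphere — the datum of a surgery along a *separating* sphere of an arbitrary manifold.  (This is
`exists_neckCapData_of_simplyConnected` of `NeckCapping.lean` with simple connectivity of `P`,
used there only to make the neck separate, replaced by that hypothesis; the packaging of the two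
halves as `NeckCapData` is the same.) [cite: Hirsch1976, Ch. 4 Lemma 4.4 (p. 107)] -/
theorem exists_neckCapData_of_not_isPreconnected [T2Space P] [ConnectedSpace P]
    [IsManifold 𝓘(ℝ, E) ∞ P] (hn : n ≠ 0)
    {ψ : sphere (0 : E) 1 × ℝ → P}
    (hψ : Manifold.IsSmoothEmbedding ((𝓡 n).prod 𝓘(ℝ, ℝ)) 𝓘(ℝ, E) ∞ ψ) (hψo : IsOpen (range ψ))
    (hC : ¬ IsPreconnected (ψ '' (univ ×ˢ {(0 : ℝ)}))ᶜ) :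
    ∃ (D₁ : NeckCapData n ψ) (D₂ : NeckCapData n (fun q : sphere (0 : E) 1 × ℝ => ψ (q.1, -q.2))),
      Disjoint (D₁.side : Set P) D₂.side ∧
      ∀ p : P, p ∉ D₁.side → p ∉ D₂.side → ∃ θ : sphere (0 : E) 1, ψ (θ, 0) = p := by
  haveI : FiniteDimensional ℝ E := .of_fact_finrank_eq_succ (K := ℝ) (V := E) n
  haveI : ConnectedSpace (sphere (0 : E) 1) := by
    have h1 : 1 < Module.rank ℝ E := by
      rw [← Module.finrank_eq_rank, (Fact.out : finrank ℝ E = n + 1)]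
      exact_mod_cast (by omega : 1 < n + 1)
    exact isConnected_iff_connectedSpace.1 (isConnected_sphere h1 (0 : E) zero_le_one)
  have hψe : _root_.Topology.IsOpenEmbedding ψ := ⟨hψ.isEmbedding, hψo⟩
  obtain ⟨A, B, hA, hB, hAB, hABZ, hIoi, hIio⟩ := exists_two_sides_of_neck_of_not_isPreconnected hψe hC
  set Z : Set P := ψ '' (univ ×ˢ {(0 : ℝ)}) with hZ
  have hZ' : (fun q : sphere (0 : E) 1 × ℝ => ψ (q.1, -q.2)) '' (univ ×ˢ {(0 : ℝ)}) = Z := by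
    apply Subset.antisymm
    · rintro _ ⟨⟨θ, t⟩, ⟨-, ht⟩, rfl⟩
      rw [mem_singleton_iff] at ht
      subst ht
      exact ⟨(θ, 0), ⟨mem_univ _, rfl⟩, by simp⟩
    · rintro _ ⟨⟨θ, t⟩, ⟨-, ht⟩, rfl⟩
      rw [mem_singleton_iff] at ht
      subst ht
      exact ⟨(θ, 0), ⟨mem_univ _, rfl⟩, by simp⟩
  have hAZ : ∀ p ∈ A, p ∉ Z := fun p hp hz => hABZ.subset (Or.inl hp) hz
  have hBZ : ∀ p ∈ B, p ∉ Z := fun p hp hz => hABZ.subset (Or.inr hp) hz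
  have hcA : (A ∪ Z)ᶜ = B := by
    ext p
    simp only [mem_compl_iff, mem_union, not_or]
    constructor
    · rintro ⟨hpA, hpZ⟩
      have : p ∈ A ∪ B := hABZ.symm.subset hpZ
      exact this.resolve_left hpA
    · intro hpB
      exact ⟨fun hpA => Set.disjoint_left.1 hAB hpA hpB, hBZ p hpB⟩
  have hcB : (B ∪ Z)ᶜ = A := by
    ext p
    simp only [mem_compl_iff, mem_union, not_or]
    constructor
    · rintro ⟨hpB, hpZ⟩
      have : p ∈ A ∪ B := hABZ.symm.subset hpZ
      exact this.resolve_right hpB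
    · intro hpA
      exact ⟨fun hpB => Set.disjoint_left.1 hAB hpA hpB, hAZ p hpA⟩
  refine ⟨⟨hψ, hψo, ⟨A, hA⟩, ?_, hIoi, ?_⟩,
    ⟨isSmoothEmbedding_neck_flip hψ, by rw [range_neck_flip]; exact hψo, ⟨B, hB⟩, ?_, ?_, ?_⟩,
    hAB, fun p h₁ h₂ => ?_⟩
  · rw [← isOpen_compl_iff, show ((⟨A, hA⟩ : TopologicalSpace.Opens P) : Set P) = A from rfl, hcA]
    exact hB
  · intro θ t ht h
    change ψ (θ, t) ∈ A at h
    rcases ht.eq_or_lt with rfl | ht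
    · exact hAZ _ h ⟨(θ, 0), ⟨mem_univ _, rfl⟩, rfl⟩
    · exact Set.disjoint_left.1 hAB h (hIio ⟨(θ, t), ⟨mem_univ _, ht⟩, rfl⟩)
  · rw [← isOpen_compl_iff, show ((⟨B, hB⟩ : TopologicalSpace.Opens P) : Set P) = B from rfl,
      hZ', hcB]
    exact hA
  · rintro _ ⟨⟨θ, t⟩, ⟨-, ht⟩, rfl⟩
    change ψ (θ, -t) ∈ B
    exact hIio ⟨(θ, -t), ⟨mem_univ _, by simpa using ht⟩, rfl⟩
  · intro θ t ht h
    change ψ (θ, -t) ∈ B at h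
    rcases ht.eq_or_lt with rfl | ht
    · rw [neg_zero] at h
      exact hBZ _ h ⟨(θ, 0), ⟨mem_univ _, rfl⟩, rfl⟩
    · exact Set.disjoint_left.1 hAB (hIoi ⟨(θ, -t), ⟨mem_univ _, by simpa using ht⟩, rfl⟩) h
  · have hp : p ∉ A ∪ B := fun h => h.elim h₁ h₂
    rw [hABZ] at hp
    obtain ⟨⟨θ, t⟩, ⟨-, ht⟩, rfl⟩ := not_notMem.1 hp
    rw [mem_singleton_iff] at ht
    subst ht
    exact ⟨θ, rfl⟩

end Sides

/-! ### Dimension three: the middle sphere of a neck with simply connected capped side is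
inessential -/

section Three

/-- Local notation: `𝔼 n` is the model Euclidean space `EuclideanSpace ℝ (Fin n)`. -/
local notation "𝔼 " n:arg => EuclideanSpace ℝ (Fin n)

/-- Local notation: `𝕊 n` is the unit sphere in `EuclideanSpace ℝ (Fin (n + 1))`. -/
local notation "𝕊 " n:arg => (Metric.sphere (0 : EuclideanSpace ℝ (Fin (n + 1))) 1)

attribute [local instance] fact_finrank_euclideanSpace_succ

variable {Y : Type} [TopologicalSpace Y] [T2Space Y] [ChartedSpace (𝔼 3) Y]
  [IsManifold (𝓡 3) ∞ Y] [CompactSpace Y]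

namespace NeckCapData

/-- **A level sphere inside a side with simply connected capped side is null-homotopic in `Y`.**
The level-`1` sphere `θ ↦ ψ (θ, 1)` lies in the side `A`; through the open embedding
`inl : A → D.Capped`, whose range is the complement of the centre of the disc, it becomes a
`2`-sphere in a once-punctured simply connected closed `3`-manifold, which is null-homotopic there
(`homotopic_const_of_simplyConnected_compl_singleton`: `H₂ = 0` of the puncture by Poincaré
duality, then Hurewicz); compose the null-homotopy with `A ⊆ Y`. (Hempel (1976), proof of
Lemma 3.13 / Thm. 3.6: a sphere cutting off a homotopy ball is inessential.)
[cite: Hempel1976, proof of Lemma 3.13] -/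
theorem exists_homotopic_const_levelOne {ψ : (𝕊 2) × ℝ → Y} (D : NeckCapData 2 ψ)
    [SimplyConnectedSpace D.Capped] :
    ∃ y : Y, (⟨fun θ => ψ (θ, 1), D.isOpenEmbedding.continuous.comp
      (Continuous.prodMk_left (1 : ℝ))⟩ : C((𝕊 2), Y)).Homotopic (ContinuousMap.const (𝕊 2) y) := by
  set c : D.Capped := D.glueData.inr 0 with hc
  -- the level-one sphere in the punctured capped side
  have hmem : ∀ θ : 𝕊 2, D.glueData.inl ⟨ψ (θ, 1), D.mem_side θ one_pos⟩ ∈ ({c}ᶜ : Set D.Capped) :=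
    fun θ => by rw [hc, ← D.range_inl]; exact mem_range_self _
  have hcontA : Continuous fun θ : 𝕊 2 => (⟨ψ (θ, 1), D.mem_side θ one_pos⟩ : D.side) :=
    (D.isOpenEmbedding.continuous.comp (Continuous.prodMk_left (1 : ℝ))).subtype_mk _
  let β : C((𝕊 2), ↥(({c}ᶜ : Set D.Capped))) :=
    ⟨fun θ => ⟨D.glueData.inl ⟨ψ (θ, 1), D.mem_side θ one_pos⟩, hmem θ⟩,
      (D.glueData.continuous_inl.comp hcontA).subtype_mk _⟩
  obtain ⟨θ₀⟩ : Nonempty (𝕊 2) := inferInstance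
  have hβ := homotopic_const_of_simplyConnected_compl_singleton c β (β θ₀)
  -- back to `Y` through the inverse of `inl` on its range
  let h : D.side ≃ₜ range D.glueData.inl := D.glueData.isOpenEmbedding_inl.isEmbedding.toHomeomorph
  have hsub : ({c}ᶜ : Set D.Capped) ⊆ range D.glueData.inl := by rw [D.range_inl]
  let g : C(↥(({c}ᶜ : Set D.Capped)), Y) :=
    ⟨fun q => ((h.symm (Set.inclusion hsub q) : D.side) : Y),
      continuous_subtype_val.comp (h.symm.continuous.comp (continuous_inclusion hsub))⟩
  have hg : ∀ θ : 𝕊 2, g (β θ) = ψ (θ, 1) := fun θ => by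
    have h1 : Set.inclusion hsub (β θ) = h ⟨ψ (θ, 1), D.mem_side θ one_pos⟩ := Subtype.ext rfl
    change ((h.symm (Set.inclusion hsub (β θ)) : D.side) : Y) = ψ (θ, 1)
    rw [h1, h.symm_apply_apply]
  refine ⟨g (β θ₀), ?_⟩
  have hcomp : (⟨fun θ => ψ (θ, 1), D.isOpenEmbedding.continuous.comp
      (Continuous.prodMk_left (1 : ℝ))⟩ : C((𝕊 2), Y)) = g.comp β := by
    ext θ
    exact (hg θ).symm
  rw [hcomp]
  exact ContinuousMap.Homotopic.comp (ContinuousMap.Homotopic.refl g) hβ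

/-- **The middle sphere of a neck with simply connected capped side is null-homotopic** in the
closed `3`-manifold `Y` (slide to level `1`, then `exists_homotopic_const_levelOne`).
[cite: Hempel1976, proof of Lemma 3.13] -/
theorem exists_homotopic_const_middleSphere {ψ : (𝕊 2) × ℝ → Y} (D : NeckCapData 2 ψ)
    [SimplyConnectedSpace D.Capped] (σ : C((𝕊 2), Y)) (hσ : ∀ θ, σ θ = ψ (θ, 0)) :
    ∃ y : Y, σ.Homotopic (ContinuousMap.const (𝕊 2) y) := by
  obtain ⟨y, hy⟩ := D.exists_homotopic_const_levelOne
  refine ⟨y, ?_⟩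
  have hσ' : σ = ⟨fun θ => ψ (θ, 0), D.isOpenEmbedding.continuous.comp
      (Continuous.prodMk_left (0 : ℝ))⟩ := by
    ext θ
    exact hσ θ
  rw [hσ']
  exact (homotopic_neckLevel D.isOpenEmbedding.continuous 0 1).trans hy

/-- The same for a side of the **flipped** neck `(θ, t) ↦ ψ (θ, -t)` (the other side of `ψ`): its
middle sphere is again `θ ↦ ψ (θ, 0)`. [cite: Hempel1976, proof of Lemma 3.13] -/
theorem exists_homotopic_const_middleSphere_flip {ψ : (𝕊 2) × ℝ → Y}
    (D : NeckCapData 2 (fun q : (𝕊 2) × ℝ => ψ (q.1, -q.2)))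
    [SimplyConnectedSpace D.Capped] (σ : C((𝕊 2), Y)) (hσ : ∀ θ, σ θ = ψ (θ, 0)) :
    ∃ y : Y, σ.Homotopic (ContinuousMap.const (𝕊 2) y) :=
  D.exists_homotopic_const_middleSphere σ fun θ => by rw [hσ θ, neg_zero]

end NeckCapData

/-! ### Surgery along a separating neck of a closed orientable `3`-manifold -/

omit [CompactSpace Y] in
/-- **Cutting a closed, connected, orientable `3`-manifold along a separating sphere with a
product neighbourhood and capping off** (Hempel, *3-Manifolds* (1976), Ch. 3, p. 21 and
Lemma 3.8, separating case; smooth category).  If `ψ : S² × ℝ ↪ Y` is a neck whose middle sphere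
`ψ (S² × {0})` separates `Y`, then the two sides `D₁` (of `ψ`) and `D₂` (of the flipped neck)
exist, `Y` is the connected sum `D₁.Capped # D₂.Capped` of the two capped sides
(`IsConnectedSum`, Kervaire–Milnor's relation), and both capped sides are closed (compact,
Hausdorff, second countable — instances of `NeckCapping.lean`), connected and orientable smooth
`3`-manifolds. [cite: Hempel1976, Ch. 3 p. 21 and Lemma 3.8] -/
theorem exists_neckCapData_of_separating_three [ConnectedSpace Y] (hY : IsOrientable (𝓡 3) Y)
    {ψ : (𝕊 2) × ℝ → Y} (hψ : Manifold.IsSmoothEmbedding ((𝓡 2).prod 𝓘(ℝ, ℝ)) (𝓡 3) ∞ ψ)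
    (hψo : IsOpen (range ψ)) (hsep : ¬ IsPreconnected (ψ '' (univ ×ˢ {(0 : ℝ)}))ᶜ) :
    ∃ (D₁ : NeckCapData 2 ψ) (D₂ : NeckCapData 2 (fun q : (𝕊 2) × ℝ => ψ (q.1, -q.2))),
      IsConnectedSum (𝓡 3) (𝓡 3) (𝓡 3) D₁.Capped D₂.Capped Y ∧
      ConnectedSpace D₁.Capped ∧ ConnectedSpace D₂.Capped ∧
      IsOrientable (𝓡 3) D₁.Capped ∧ IsOrientable (𝓡 3) D₂.Capped := by
  obtain ⟨D₁, D₂, hdisj, hcover⟩ := exists_neckCapData_of_not_isPreconnected two_ne_zero hψ hψo hsep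
  exact ⟨D₁, D₂, D₁.isConnectedSum_capped' D₂ hdisj hcover,
    D₁.connectedSpace_capped_left D₂ hdisj hcover, D₁.connectedSpace_capped_right D₂ hdisj hcover,
    D₁.isOrientable_capped hY two_ne_zero, D₂.isOrientable_capped hY two_ne_zero⟩

end Three

end Literature.Topology.FourManifolds
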